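/-
Copyright (c) 2026 the pub-hodgecm-mathlib formalisation cell (harness21).  Prover seat hodgecm-mathlib-K2E3-p24 (g0), HCML Track B «K2-LIT» ∕ h413
(`stmt-HodgeConjecture-24833`), line `K2_E3_EllipticInputs`, road «GL₂-sc» (road owner K2E5-p17 (g5), dealer K2E3-plan (g4)), NON-ELLIPTIC half (lead K2E3-p23 (g6)),
brick 2N-6, FILE 1 OF 4 (part 1 of the ψ-free split half of Theorem 15 at `N = 2`): the algebra of the split regular semisimple set `𝔤′ ⊆ 𝔤𝔩₂`, its openness, the
box of a compact set under `Ad(K)`, and the box integral `∫_{(𝔭^n)³} ‖r₀ − r₂‖^{-a} dr < ∞` (`a < 1`).  2026-09-04.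
-/
import Summits.HodgeConjecture.HodgeConjecture.Theorems.K2E3GL2BorelSliceKIntegral               -- ★ (C) (K2E5-p10 (g4)): brings ★ `isOpen_setOf_isSquare_and_ne_zero`, ★ `continuous_discr_charpoly`, the `glInt 2 F` frame
import Summits.HodgeConjecture.HodgeConjecture.Theorems.K2E3GL3SplitDiscriminantBoxIntegral      -- ★ part 1 at N = 3 (K2E3-p17 (g7)): one-variable kit `lintegral_indicator_normAbs_sub_rpow_neg`; brings Literature ★ `LocalFieldHaar.lintegral_coe_normAbs_rpow_neg_lt_top`
import Summits.HodgeConjecture.HodgeConjecture.Theorems.K2E3GL2ModUniformizerCentralizerDichotomy -- ★ 2N-0b F1 p858823 (K2E3-p23 (g6)): `card_roots_charpoly_two_eq_zero_or_two`, `exists_conj_diagonal_of_card_roots_eq_two`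
import Literature.MeasureTheory.Group.LocalFieldGLnVolume                                        -- ★ `isOpen_setOf_forall_mem_primePowBall` (the boxes `M₂(𝔭^k)`)
import HarnessLib

/-!
# K2_E3 road (h413), road «GL₂-sc», brick 2N-6 (1∕4) — T15 split half at `N = 2`, part 1: `𝔤′ = (disc χ)⁻¹(Fˣ²)`, boxes, and `∫_{(𝔭^n)³} ‖r₀ − r₂‖^{-a} dr`

Cell `pub/hodgecm-mathlib` (D-0151), Track B, seat K2E3-p24 (g0) (hand on the NON-ELLIPTIC half of road «GL₂-sc», brick 2N-6 by name).  `--supports stmt-HodgeConjecture-24833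
--as helper`; THEOREMS ONLY (no definition ∕ instance ∕ notation ∕ named fact ∕ `sorry`); never imports `Cruxes/…/Lines`.  COUNT-NEUTRAL.  The `Fin 2` reading of ★
`K2E3GL3SplitDiscriminantBoxIntegral` + ★ (3J) §1 (K2E3-p17 (g7)); consumed by part 2 `K2E3GL2SplitDiscriminantLocIntegrable` (the ψ-free local integrability of
`1_{𝔤′} ‖disc χ‖^{-(1/2+ε)}` on `𝔤𝔩₂(F)`).

* §0 (any field `K`): `disc χ_{[[r₀,r₁],[0,r₂]]} = (r₀ − r₂)²` (`discr_charpoly_borelSlice`); `disc χ_{g·diag(d)·g⁻¹} = (d₀ − d₁)²` (`discr_charpoly_conj_diagonal`); and, for `2 ≠ 0`,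
  **`discr_ne_zero_and_card_roots_eq_two_iff`**: `disc χ_Y ≠ 0 ∧ #roots_K χ_Y = 2 ⇔ disc χ_Y ∈ (Kˣ)²` (two rational roots ⇒ diagonalisable, ★ `exists_conj_diagonal_of_card_roots_eq_two`;
  `disc = s² ≠ 0` ⇒ `(tr Y + s)∕2` is a root of `X² − tr Y·X + det Y`, so `#roots ≠ 0`, hence `= 2` by ★ `card_roots_charpoly_two_eq_zero_or_two`); `setOf_discr_ne_zero_and_card_roots_eq_two_eq`.
* §1 (non-archimedean local field `F`): **`isOpen_setOf_charpoly_discr_ne_zero_and_card_roots_eq_two`** (preimage of the open non-zero squares ★ `isOpen_setOf_isSquare_and_ne_zero`);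
  `exists_forall_mem_primePowBall_of_isCompact` (a compact set of `2 × 2` matrices lies in a box `M₂(𝔭^{-n})`); `exists_forall_conj_borelSlice_mem_imp`
  (`k b(r) k⁻¹ ∈ S`, `k ∈ GL₂(𝒪)` ⇒ `r ∈ (𝔭^{-m})³`); **`lintegral_pi_three_box_normAbs_sub_rpow_neg_le`** ∕ **`…_lt_top`**: `∫_{(𝔭^n)³} ‖r₀ − r₂‖^{-a} dr ≤ I(a)·dx(𝔭^n)² < ∞`
  for `a < 1`, `I(a) = ∫_{𝔭^n} ‖u‖^{-a} du` (peel `r₀` by translation, `lmarginal` bookkeeping as in ★ part 1 at `N = 3`).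
[HarishChandra1970, Part V §6 Thm. 15, Part VII §3] [HarishChandra1999AdmissibleDistributions, §7, Lemma 7.9] [WeilBNT1967, Ch. I §2–§4, Ch. II n° 27]
HONEST LABEL: HC_CM is proved only modulo the 7 printed citations (2 remaining named inputs: hLiu418 = stmt-HodgeConjecture-24832, h413 = stmt-HodgeConjecture-24833)
until rung 0 closes; count-neutral helper.

## Mathlib ∕ tree search
Tree: ★ `isOpen_setOf_isSquare_and_ne_zero`, ★ `continuous_discr_charpoly`, ★ `card_roots_charpoly_two_eq_zero_or_two`, ★ `exists_conj_diagonal_of_card_roots_eq_two`, ★ `isCompact_glInt`,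
★ `lintegral_indicator_normAbs_sub_rpow_neg`, Literature ★ `lintegral_coe_normAbs_rpow_neg_lt_top`, ★ `measure_primePowBall_lt_top`, ★ `isOpen_setOf_forall_mem_primePowBall`.
Mathlib: `Matrix.discr_fin_two`, `Matrix.discr_conj`, `Matrix.charpoly_fin_two`, `lintegral_eq_lmarginal_univ`, `lmarginal_insert'`, `lmarginal_singleton`.
Dedup: `rg "card_roots_eq_two_iff|box_normAbs_sub_rpow|GL2SplitDiscriminant"` over Literature∕Summits — only the `Fin 3` twins ★ `K2E3GL3SplitDiscriminantBoxIntegral` ∕ ★ (3J) §1.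

## References
* [HarishChandra1970] Harish-Chandra (van Dijk), *Harmonic Analysis on Reductive p-adic Groups*, LNM 162 (1970), Part V §6 Thm. 15, Part VII §3.
* [HarishChandra1999AdmissibleDistributions] Harish-Chandra (DeBacker–Sally), *Admissible Invariant Distributions on Reductive p-adic Groups* (1999), §7, Lemma 7.9.
* [WeilBNT1967] A. Weil, *Basic Number Theory* (1967), Ch. I §2–§4, Ch. II n° 27.
-/

set_option autoImplicit false
set_option linter.dupNamespace false

noncomputable section

open MeasureTheory MeasureTheory.Measure Set Matrix Topology Polynomial Filter
open scoped MatrixGroups NNReal ENNReal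
open ValuativeRel
open Literature.NumberTheory.GaloisRepresentations Literature.NumberTheory.GaloisRepresentations.IsNonarchimedeanLocalField
open Literature.NumberTheory.Automorphic Literature.NumberTheory.Automorphic.LocalFieldHaar
open Summit.HodgeConjecture.HodgeConjecture.Cruxes.H413.K2E3LocalFieldSquaresHensel
open Summit.HodgeConjecture.HodgeConjecture.Cruxes.H413.K2E3GL2RegularNilpotentFourierLineInversion
open Summit.HodgeConjecture.HodgeConjecture.Cruxes.H413.K2E3GL2BorelSliceKIntegral
open Summit.HodgeConjecture.HodgeConjecture.Cruxes.H413.K2E3NormalizedCharBddNearSemisimpleRegular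
open Summit.HodgeConjecture.HodgeConjecture.Cruxes.H413.K2E3GL2ModUniformizerCentralizerDichotomy
open Summit.HodgeConjecture.HodgeConjecture.Cruxes.H413.K2E3GL3SplitDiscriminantBoxIntegral

namespace Summit.HodgeConjecture.HodgeConjecture.Cruxes.H413.K2E3GL2SplitDiscriminantBoxIntegral

/-! ## §0  Algebra over a field: the slice, diagonalisable matrices, and `𝔤′ = (disc χ)⁻¹(non-zero squares)` -/

section FieldAlgebra

variable {K : Type*} [Field K]

/-- **`disc χ_{b(r)} = (r₀ − r₂)²`** for the Borel slice `b(r) = [[r₀,r₁],[0,r₂]]` of `𝔤𝔩₂` (Mathlib `Matrix.discr_fin_two`: `disc χ = tr² − 4 det`).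
[cite: HarishChandra1999AdmissibleDistributions, §7] -/
theorem discr_charpoly_borelSlice (r : Fin 3 → K) :
    ((!![r 0, r 1; 0, r 2] : Matrix (Fin 2) (Fin 2) K)).charpoly.discr = (r 0 - r 2) ^ 2 := by
  change Matrix.discr _ = _
  rw [Matrix.discr_fin_two, Matrix.trace_fin_two, Matrix.det_fin_two]
  simp only [Matrix.of_apply, Matrix.cons_val', Matrix.cons_val_zero, Matrix.cons_val_one, Matrix.cons_val_fin_one]
  ring

/-- **`disc χ_{g · diag(d) · g⁻¹} = (d₀ − d₁)²`** (`χ` is a class function; `tr diag(d) = d₀ + d₁`, `det diag(d) = d₀ d₁`). [cite: HarishChandra1970, Part I §5] -/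
theorem discr_charpoly_conj_diagonal (g : GL (Fin 2) K) (d : Fin 2 → K) :
    ((g : Matrix (Fin 2) (Fin 2) K) * Matrix.diagonal d * ((g⁻¹ : GL (Fin 2) K) : Matrix (Fin 2) (Fin 2) K)).charpoly.discr = (d 0 - d 1) ^ 2 := by
  rw [Matrix.coe_units_inv]
  change Matrix.discr _ = _
  rw [Matrix.discr_conj, Matrix.discr_fin_two, Matrix.trace_diagonal, Matrix.det_diagonal, Fin.sum_univ_two, Fin.prod_univ_two]
  ring

/-- **Two rational roots with non-zero discriminant ⇔ the discriminant is a non-zero square** (`2 × 2` matrices over a field with `2 ≠ 0`): two rational roots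
make `Y` diagonalisable (★ `exists_conj_diagonal_of_card_roots_eq_two`), so `disc χ_Y = (d₀ − d₁)²`; conversely if `disc χ_Y = s² ≠ 0` then `(tr Y + s)∕2` is a root of
`χ_Y = X² − tr Y · X + det Y`, so `#roots ≠ 0`, hence `= 2` (★ `card_roots_charpoly_two_eq_zero_or_two`). [cite: HarishChandra1970, Part VII §3] -/
theorem discr_ne_zero_and_card_roots_eq_two_iff (h2 : (2 : K) ≠ 0) (Y : Matrix (Fin 2) (Fin 2) K) :
    (Y.charpoly.discr ≠ 0 ∧ Y.charpoly.roots.card = 2) ↔ (IsSquare Y.charpoly.discr ∧ Y.charpoly.discr ≠ 0) := by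
  constructor
  · rintro ⟨hD, hcard⟩
    obtain ⟨g, d, -, hY⟩ := exists_conj_diagonal_of_card_roots_eq_two Y hcard hD
    refine ⟨?_, hD⟩
    rw [hY, discr_charpoly_conj_diagonal]
    exact ⟨d 0 - d 1, sq _⟩
  · rintro ⟨⟨s, hs⟩, hD⟩
    refine ⟨hD, ?_⟩
    have hs' : Y.trace ^ 2 - 4 * Y.det = s * s := by rw [← Matrix.discr_fin_two]; exact hs
    have hroot : Y.charpoly.IsRoot ((Y.trace + s) / 2) := by
      rw [Polynomial.IsRoot.def, Matrix.charpoly_fin_two]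
      simp only [eval_add, eval_sub, eval_pow, eval_X, eval_mul, eval_C]
      have h4 : (4 : K) ≠ 0 := by
        have h22 : (4 : K) = 2 * 2 := by norm_num
        rw [h22]; exact mul_ne_zero h2 h2
      have key : ((Y.trace + s) / 2) ^ 2 - Y.trace * ((Y.trace + s) / 2) + Y.det = (s * s - (Y.trace ^ 2 - 4 * Y.det)) / 4 := by
        field_simp
        ring
      rw [key, hs', sub_self, zero_div]
    have hmem : (Y.trace + s) / 2 ∈ Y.charpoly.roots := (Polynomial.mem_roots (Matrix.charpoly_monic Y).ne_zero).2 hroot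
    have hpos : 0 < Y.charpoly.roots.card := Multiset.card_pos_iff_exists_mem.2 ⟨_, hmem⟩
    rcases card_roots_charpoly_two_eq_zero_or_two Y with h0 | h
    · exact absurd h0 hpos.ne'
    · exact h

/-- **`𝔤′ = (disc χ)⁻¹{non-zero squares}`**: the split regular semisimple set of `𝔤𝔩₂(K)` as a preimage (`2 ≠ 0`). [cite: HarishChandra1999AdmissibleDistributions, §7] -/
theorem setOf_discr_ne_zero_and_card_roots_eq_two_eq (h2 : (2 : K) ≠ 0) :
    {Y : Matrix (Fin 2) (Fin 2) K | Y.charpoly.discr ≠ 0 ∧ Y.charpoly.roots.card = 2} =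
      (fun Y : Matrix (Fin 2) (Fin 2) K => Y.charpoly.discr) ⁻¹' {D : K | IsSquare D ∧ D ≠ 0} :=
  Set.ext fun Y => discr_ne_zero_and_card_roots_eq_two_iff h2 Y

end FieldAlgebra

/-! ## §1  Local field: `𝔤′` is open; the box of a compact set; the box integral `∫_{(𝔭^n)³} ‖r₀ − r₂‖^{-a} dr` -/

section LocalField

variable {F : Type*} [Field F] [ValuativeRel F] [TopologicalSpace F] [IsNonarchimedeanLocalField F]

/-- **The split regular semisimple set `𝔤′ = {disc χ ≠ 0, #roots = 2}` of `𝔤𝔩₂(F)` is open** (`2 ≠ 0`): the preimage of the open set of non-zero squares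
(★ `isOpen_setOf_isSquare_and_ne_zero`, Hensel) under the continuous `disc χ` (★ `continuous_discr_charpoly`). [cite: HarishChandra1999AdmissibleDistributions, §7] -/
theorem isOpen_setOf_charpoly_discr_ne_zero_and_card_roots_eq_two (h2 : (2 : F) ≠ 0) :
    IsOpen {Y : Matrix (Fin 2) (Fin 2) F | Y.charpoly.discr ≠ 0 ∧ Y.charpoly.roots.card = 2} := by
  rw [setOf_discr_ne_zero_and_card_roots_eq_two_eq h2]
  exact (isOpen_setOf_isSquare_and_ne_zero h2).preimage (continuous_discr_charpoly (R := F) (n := Fin 2))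

/-- **A compact set of `2 × 2` matrices has entries in one ball `𝔭^{-n}`** (`M₂(F) = ⋃_n M₂(𝔭^{-n})`, increasing open cover; the `Fin 2` reading of ★ (3J) §1).
[cite: WeilBNT1967, Ch. II n° 27] -/
theorem exists_forall_mem_primePowBall_of_isCompact {S : Set (Matrix (Fin 2) (Fin 2) F)} (hS : IsCompact S) :
    ∃ n : ℕ, ∀ Y ∈ S, ∀ i j, Y i j ∈ primePowBall F (-(n : ℤ)) := by
  classical
  have hcov : S ⊆ ⋃ n : ℕ, {Y : Matrix (Fin 2) (Fin 2) F | ∀ i j, Y i j ∈ primePowBall F (-(n : ℤ))} := by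
    intro Y _
    have hm : ∀ p : Fin 2 × Fin 2, ∃ m : ℤ, Y p.1 p.2 ∈ primePowBall F m := fun p => exists_mem_primePowBall (Y p.1 p.2)
    choose m hm using hm
    refine Set.mem_iUnion.2 ⟨Finset.univ.sup fun p => (m p).natAbs, fun i j => primePowBall_antitone ?_ (hm (i, j))⟩
    have h1 : (m (i, j)).natAbs ≤ Finset.univ.sup fun p : Fin 2 × Fin 2 => (m p).natAbs :=
      Finset.le_sup (f := fun p : Fin 2 × Fin 2 => (m p).natAbs) (Finset.mem_univ (i, j))
    omega
  obtain ⟨n, hn⟩ := hS.elim_directed_cover (fun n : ℕ => {Y : Matrix (Fin 2) (Fin 2) F | ∀ i j, Y i j ∈ primePowBall F (-(n : ℤ))})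
    (fun n => Literature.MeasureTheory.Group.isOpen_setOf_forall_mem_primePowBall (F := F) (n := Fin 2) (-(n : ℤ)))
    hcov (Monotone.directed_le fun a b hab Y (hY : ∀ i j, Y i j ∈ _) i j => primePowBall_antitone (by omega) (hY i j))
  exact ⟨n, fun Y hY => hn hY⟩

/-- **The slice coordinates hitting a compact set are bounded, uniformly over `K = GL₂(𝒪)`**: for compact `S ⊆ 𝔤𝔩₂(F)` there is `m` with
`k b(r) k⁻¹ ∈ S ⇒ r ∈ (𝔭^{-m})³` (`Ad(K)⁻¹ S` is compact). [cite: WeilBNT1967, Ch. II n° 27] -/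
theorem exists_forall_conj_borelSlice_mem_imp {S : Set (Matrix (Fin 2) (Fin 2) F)} (hS : IsCompact S) :
    ∃ m : ℕ, ∀ (k : ↥(glInt 2 F)) (r : Fin 3 → F),
      ((k : GL (Fin 2) F) : Matrix (Fin 2) (Fin 2) F) * !![r 0, r 1; 0, r 2] * ((((k : GL (Fin 2) F))⁻¹ : GL (Fin 2) F) : Matrix (Fin 2) (Fin 2) F) ∈ S →
        ∀ i, r i ∈ primePowBall F (-(m : ℤ)) := by
  haveI : T2Space F := (isLocalField F).toT2Space
  haveI : IsTopologicalRing F := inferInstance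
  have hSK : IsCompact ((fun p : ↥(glInt 2 F) × Matrix (Fin 2) (Fin 2) F =>
      ((((p.1 : GL (Fin 2) F))⁻¹ : GL (Fin 2) F) : Matrix (Fin 2) (Fin 2) F) * p.2 * ((p.1 : GL (Fin 2) F) : Matrix (Fin 2) (Fin 2) F)) '' (univ ×ˢ S)) := by
    haveI : CompactSpace ↥(glInt 2 F) := isCompact_iff_compactSpace.1 (isCompact_glInt 2 F)
    exact (isCompact_univ.prod hS).image ((((Units.continuous_coe_inv.comp (continuous_subtype_val.comp continuous_fst))).mul continuous_snd).mul
      (Units.continuous_val.comp (continuous_subtype_val.comp continuous_fst)))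
  obtain ⟨m, hm⟩ := exists_forall_mem_primePowBall_of_isCompact hSK
  refine ⟨m, fun k r hkr i => ?_⟩
  have hb : (!![r 0, r 1; 0, r 2] : Matrix (Fin 2) (Fin 2) F) ∈ (fun p : ↥(glInt 2 F) × Matrix (Fin 2) (Fin 2) F =>
      ((((p.1 : GL (Fin 2) F))⁻¹ : GL (Fin 2) F) : Matrix (Fin 2) (Fin 2) F) * p.2 * ((p.1 : GL (Fin 2) F) : Matrix (Fin 2) (Fin 2) F)) '' (univ ×ˢ S) := by
    refine ⟨(k, ((k : GL (Fin 2) F) : Matrix (Fin 2) (Fin 2) F) * !![r 0, r 1; 0, r 2] *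
      ((((k : GL (Fin 2) F))⁻¹ : GL (Fin 2) F) : Matrix (Fin 2) (Fin 2) F)), ⟨Set.mem_univ _, hkr⟩, ?_⟩
    simp only
    rw [show ((((k : GL (Fin 2) F))⁻¹ : GL (Fin 2) F) : Matrix (Fin 2) (Fin 2) F) * (((k : GL (Fin 2) F) : Matrix (Fin 2) (Fin 2) F) *
        !![r 0, r 1; 0, r 2] * ((((k : GL (Fin 2) F))⁻¹ : GL (Fin 2) F) : Matrix (Fin 2) (Fin 2) F)) * ((k : GL (Fin 2) F) : Matrix (Fin 2) (Fin 2) F)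
        = (((((k : GL (Fin 2) F))⁻¹ : GL (Fin 2) F) : Matrix (Fin 2) (Fin 2) F) * ((k : GL (Fin 2) F) : Matrix (Fin 2) (Fin 2) F)) * !![r 0, r 1; 0, r 2] *
        (((((k : GL (Fin 2) F))⁻¹ : GL (Fin 2) F) : Matrix (Fin 2) (Fin 2) F) * ((k : GL (Fin 2) F) : Matrix (Fin 2) (Fin 2) F)) by simp only [Matrix.mul_assoc],
      Units.inv_mul, Matrix.one_mul, Matrix.mul_one]
  have he := hm _ hb
  fin_cases i
  · exact he 0 0
  · exact he 0 1
  · exact he 1 1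

variable [MeasurableSpace F] [BorelSpace F] (dx : Measure F) [dx.IsAddHaarMeasure]

/-- **THE BOX INTEGRAL `∫_{(𝔭^n)³} ‖r₀ − r₂‖^{-a} dr ≤ I(a) · dx(𝔭^n)²`**, `I(a) = ∫_{𝔭^n} ‖u‖^{-a} du` (peel `r₀` by translation ★ `lintegral_indicator_normAbs_sub_rpow_neg`,
then `r₁`, `r₂` are free in the ball; `lmarginal` bookkeeping as in ★ part 1 at `N = 3`). [cite: HarishChandra1970, Part V §6 Thm. 15] [cite: WeilBNT1967, Ch. I §2] -/
theorem lintegral_pi_three_box_normAbs_sub_rpow_neg_le (n : ℤ) (a : ℝ) :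
    ∫⁻ r : Fin 3 → F, ((primePowBall F n).indicator (1 : F → ℝ≥0∞) (r 0) * (primePowBall F n).indicator (1 : F → ℝ≥0∞) (r 1) *
        (primePowBall F n).indicator (1 : F → ℝ≥0∞) (r 2)) * ((normAbs F (r 0 - r 2) : ℝ≥0∞)) ^ (-a) ∂(Measure.pi fun _ : Fin 3 => dx) ≤
      (∫⁻ u in primePowBall F n, ((normAbs F u : ℝ≥0∞)) ^ (-a) ∂dx) * dx (primePowBall F n) * dx (primePowBall F n) := by
  classical
  haveI : T2Space F := (isLocalField F).toT2Space
  haveI : LocallyCompactSpace F := (isLocalField F).toLocallyCompactSpace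
  haveI : SecondCountableTopology F := secondCountableTopology_localField F
  haveI : IsTopologicalRing F := inferInstance
  haveI : SFinite dx := inferInstance
  set B : Set F := primePowBall F n with hB
  have hBm : MeasurableSet B := measurableSet_primePowBall n
  set I : ℝ≥0∞ := ∫⁻ u in B, ((normAbs F u : ℝ≥0∞)) ^ (-a) ∂dx with hI
  set f : (Fin 3 → F) → ℝ≥0∞ := fun r => (B.indicator (1 : F → ℝ≥0∞) (r 0) * B.indicator (1 : F → ℝ≥0∞) (r 1) * B.indicator (1 : F → ℝ≥0∞) (r 2)) *
    ((normAbs F (r 0 - r 2) : ℝ≥0∞)) ^ (-a) with hf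
  have hind : Measurable (B.indicator (1 : F → ℝ≥0∞)) := measurable_one.indicator hBm
  have hpow : Measurable fun r : Fin 3 → F => ((normAbs F (r 0 - r 2) : ℝ≥0∞)) ^ (-a) :=
    (measurable_normAbs.comp ((measurable_pi_apply 0).sub (measurable_pi_apply 2))).coe_nnreal_ennreal.pow_const _
  have hfm : Measurable f :=
    (((hind.comp (measurable_pi_apply 0)).mul (hind.comp (measurable_pi_apply 1))).mul (hind.comp (measurable_pi_apply 2))).mul hpow
  -- peel `r₀`: `∫ f(update r 0 t) dt ≤ G₁ r := I · 1_B(r₁) 1_B(r₂)`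
  set G₁ : (Fin 3 → F) → ℝ≥0∞ := fun r => I * (B.indicator (1 : F → ℝ≥0∞) (r 1) * B.indicator (1 : F → ℝ≥0∞) (r 2)) with hG₁
  have hG₁m : Measurable G₁ := ((hind.comp (measurable_pi_apply 1)).mul (hind.comp (measurable_pi_apply 2))).const_mul _
  have h10 : (1 : Fin 3) ≠ 0 := by decide
  have h20 : (2 : Fin 3) ≠ 0 := by decide
  have h21 : (2 : Fin 3) ≠ 1 := by decide
  have hstep1 : ∀ r : Fin 3 → F, ∫⁻ t, f (Function.update r 0 t) ∂dx ≤ G₁ r := by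
    intro r
    have hupd : ∀ t, f (Function.update r 0 t) = (B.indicator (1 : F → ℝ≥0∞) (r 1) * B.indicator (1 : F → ℝ≥0∞) (r 2)) *
        (B.indicator (1 : F → ℝ≥0∞) t * ((normAbs F (t - r 2) : ℝ≥0∞)) ^ (-a)) := by
      intro t
      simp only [hf, Function.update_self, Function.update_of_ne h10, Function.update_of_ne h20]
      ring
    simp_rw [hupd]
    have hm : Measurable fun t : F => B.indicator (1 : F → ℝ≥0∞) t * ((normAbs F (t - r 2) : ℝ≥0∞)) ^ (-a) :=
      hind.mul ((measurable_normAbs.comp (measurable_id.sub_const (r 2))).coe_nnreal_ennreal.pow_const _)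
    rw [lintegral_const_mul _ hm]
    by_cases hr2 : r 2 ∈ B
    · have hrew : ∫⁻ t, B.indicator (1 : F → ℝ≥0∞) t * ((normAbs F (t - r 2) : ℝ≥0∞)) ^ (-a) ∂dx =
          ∫⁻ t, B.indicator (fun t => ((normAbs F (t - r 2) : ℝ≥0∞)) ^ (-a)) t ∂dx := by
        refine lintegral_congr fun t => ?_
        by_cases ht : t ∈ B
        · rw [indicator_of_mem ht, indicator_of_mem ht, Pi.one_apply, one_mul]
        · rw [indicator_of_notMem ht, indicator_of_notMem ht, zero_mul]
      rw [hrew, lintegral_indicator_normAbs_sub_rpow_neg dx hr2]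
      simp only [hG₁]
      rw [mul_comm]
    · have h0 : B.indicator (1 : F → ℝ≥0∞) (r 2) = 0 := indicator_of_notMem hr2 _
      rw [h0]; simp
  -- peel `r₁`: `∫ G₁(update r 1 t) dt = G₂ r := I · dx(B) · 1_B(r₂)`
  set G₂ : (Fin 3 → F) → ℝ≥0∞ := fun r => I * dx B * B.indicator (1 : F → ℝ≥0∞) (r 2) with hG₂
  have hstep2 : ∀ r : Fin 3 → F, ∫⁻ t, G₁ (Function.update r 1 t) ∂dx ≤ G₂ r := by
    intro r
    have hupd : ∀ t, G₁ (Function.update r 1 t) = (I * B.indicator (1 : F → ℝ≥0∞) (r 2)) * B.indicator (1 : F → ℝ≥0∞) t := by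
      intro t
      simp only [hG₁, Function.update_self, Function.update_of_ne h21]
      ring
    simp_rw [hupd]
    rw [lintegral_const_mul _ hind, lintegral_indicator_one hBm]
    simp only [hG₂]
    rw [mul_right_comm]
  -- assemble with `lmarginal`
  have huniv : (Finset.univ : Finset (Fin 3)) = insert 0 (insert 1 {2}) := by decide
  have h0 : (0 : Fin 3) ∉ (insert 1 {2} : Finset (Fin 3)) := by decide
  have h1 : (1 : Fin 3) ∉ ({2} : Finset (Fin 3)) := by decide
  set x₀ : Fin 3 → F := fun _ => 0 with hx₀
  have hG₂m : Measurable G₂ := (hind.comp (measurable_pi_apply 2)).const_mul _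
  rw [lintegral_eq_lmarginal_univ x₀, huniv, lmarginal_insert' _ hfm h0]
  calc (∫⋯∫⁻_insert 1 {2}, (fun r => ∫⁻ t, f (Function.update r 0 t) ∂dx) ∂fun _ : Fin 3 => dx) x₀
      ≤ (∫⋯∫⁻_insert 1 {2}, G₁ ∂fun _ : Fin 3 => dx) x₀ := lmarginal_mono (fun r => hstep1 r) x₀
    _ = (∫⋯∫⁻_{2}, (fun r => ∫⁻ t, G₁ (Function.update r 1 t) ∂dx) ∂fun _ : Fin 3 => dx) x₀ := by rw [lmarginal_insert' _ hG₁m h1]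
    _ ≤ (∫⋯∫⁻_{2}, G₂ ∂fun _ : Fin 3 => dx) x₀ := lmarginal_mono (fun r => hstep2 r) x₀
    _ = ∫⁻ t, G₂ (Function.update x₀ 2 t) ∂dx := by rw [lmarginal_singleton]
    _ = I * dx B * dx B := by
        simp only [hG₂, Function.update_self]
        rw [lintegral_const_mul _ hind, lintegral_indicator_one hBm]

/-- **`∫_{(𝔭^n)³} ‖r₀ − r₂‖^{-a} dr < ∞` for `a < 1`** (Literature ★ `lintegral_coe_normAbs_rpow_neg_lt_top`: `∫_{𝔭^n} ‖u‖^{-a} du < ∞`, and `dx(𝔭^n) < ∞`).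
[cite: HarishChandra1970, Part V §6 Thm. 15] [cite: Tate1950, §2.4] -/
theorem lintegral_pi_three_box_normAbs_sub_rpow_neg_lt_top (n : ℤ) {a : ℝ} (ha : a < 1) :
    ∫⁻ r : Fin 3 → F, ((primePowBall F n).indicator (1 : F → ℝ≥0∞) (r 0) * (primePowBall F n).indicator (1 : F → ℝ≥0∞) (r 1) *
        (primePowBall F n).indicator (1 : F → ℝ≥0∞) (r 2)) * ((normAbs F (r 0 - r 2) : ℝ≥0∞)) ^ (-a) ∂(Measure.pi fun _ : Fin 3 => dx) < ∞ := by
  haveI : T2Space F := (isLocalField F).toT2Space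
  haveI : LocallyCompactSpace F := (isLocalField F).toLocallyCompactSpace
  refine (lintegral_pi_three_box_normAbs_sub_rpow_neg_le dx n a).trans_lt ?_
  have h1 : ∫⁻ u in primePowBall F n, ((normAbs F u : ℝ≥0∞)) ^ (-a) ∂dx < ∞ := lintegral_coe_normAbs_rpow_neg_lt_top dx ha n
  exact ENNReal.mul_lt_top (ENNReal.mul_lt_top h1 (measure_primePowBall_lt_top dx n)) (measure_primePowBall_lt_top dx n)

end LocalField

end Summit.HodgeConjecture.HodgeConjecture.Cruxes.H413.K2E3GL2SplitDiscriminantBoxIntegral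

end
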